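import Summits.QuantumAdvantage.QuantumAdvantage.Theorems.InnerDegreeLawsJ

set_option linter.dupNamespace false

/-!
# LIVENESS SEPARATION, part H (lens 4, g28 cycle 4b) — the TWO-LABEL family pattern has full row rank (Lemma N5; kernel step T2-K2)

Blocker `X = AbsorptionDial.NoPerfectPolyOdd` (item 28487); rung-2 piece `TwoQuadNoPerfectOdd`, ENDS configuration (NODE-g28 §5e).  After the
MERGE LAW (part G) the ends configuration is a ONE-exceptional-register game whose exceptional register fires as a Boolean function of TWO
quadratic labels; on a combinatorial rectangle with cube rows `1_S` (`S ⊆ U`) and a jointly column-saturated column family the live firing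
pattern of that register is a TWO-LABEL FAMILY PATTERN
`[H_i(⟨(1,a_i), w¹⟩, ⟨(1,a_i), w²⟩)]_{i ∈ ι, (w¹,w²) ∈ 𝔽_p^{r+1} × 𝔽_p^{r+1}}`, `a` injective, `H_i : 𝔽_p² → K` non-constant.
Kernel-checked here (characteristic-two `K ∋ μ_p`, `p ≥ 5`; everything over the tree's `fcoef` / `charMat` / `lineRep` of InnerDegreeLawsG/J):

* `fourier_inv₂`, `exists_fcoef₂_ne_zero` — Fourier inversion on `𝔽_p²` (iterated one-variable inversion) and a nonzero coefficient at a
  nonzero frequency PAIR for every non-constant `H`;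
* `famMat₂_mul_charMat₂` — the factorisation `P₂ = M₂ · (F ⊗ F)` with the Kronecker square of the character matrix (invertible,
  `isUnit_charMat₂_det`), `M₂[i,(u¹,u²)] = Σ_{(s,t) : s•ℓ_i = u¹, t•ℓ_i = u²} Ĥ_i(s,t)`;
* `famMat₂_submatrix` — on the columns `(s_i•ℓ_i, t_i•ℓ_i)`, `(s_i,t_i) ≠ (0,0)`, `M₂` is DIAGONAL: the frequency pairs of two distinct affine
  points `ℓ_i = (1,a_i)` meet only at `(0,0)` (first coordinate `1` pins the scalar, injectivity of `a` the point);
* ★ `rank_famPat₂_ge` — rank `≥ |ι|` (LEMMA N5 of NODE-g28 §5e), `rank_famPat₂_flat_ge` — the same through a product of affine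
  reparametrisations of the two column labels;
* ★ `loss_of_twoLabelRectangle` — the game corollary: registers `k`-form except `g₀`, `g₀` live on a disjoint-support rectangle with columns
  indexed by ALL pairs `(w¹,w²)` and firing there as `G_i(⟨ℓ_i, N₁w¹ + w₁⟩, ⟨ℓ_i, N₂w² + w₂⟩)` with row-dependent non-constant two-label tables
  `G_i`, `|ι| > (n+1)·2p^k + 1` ⇒ a losing input (tree `loss_of_rectRank`).  With part G (`merge`, `loss_of_merge_loss`, `coLive_ends`) this is
  the (P3)₂ step of claim T2′: the two END registers of `TwoQuadNoPerfectOdd` merge into one two-label register (part I composes them).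
-/

open Finset
open scoped Kronecker
open Summit.QuantumAdvantage.AdviceFreeQNC0
open Summit.QuantumAdvantage.QuantumAdvantage.Theorems.InnerDegreeDial

namespace Summit.QuantumAdvantage.QuantumAdvantage.Theorems.LivenessSeparation

section TwoLabel

variable {K : Type*} [Field K] [CharP K 2]
variable {p : ℕ} [Fact p.Prime]

/-- two-variable Fourier coefficient `Ĥ(s,t) = Σ_{x,x'} H(x,x') ψ(−sx) ψ(−tx')` of `H : 𝔽_p² → K` (the one-variable `fcoef`, iterated) -/
noncomputable def fcoef₂ {ω : K} (hω : IsPrimitiveRoot ω p) (H : ZMod p → ZMod p → K) (s t : ZMod p) : K :=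
  fcoef hω (fun x => fcoef hω (H x) t) s

/-- Fourier inversion on `𝔽_p²` in characteristic two -/
theorem fourier_inv₂ (hp5 : 5 ≤ p) {ω : K} (hω : IsPrimitiveRoot ω p) (H : ZMod p → ZMod p → K) (z z' : ZMod p) :
    ∑ s, ∑ t, fcoef₂ hω H s t * (Coset21.CharTwoKill.chi ω hω (s * z) * Coset21.CharTwoKill.chi ω hω (t * z')) = H z z' := by
  classical
  calc ∑ s, ∑ t, fcoef₂ hω H s t * (Coset21.CharTwoKill.chi ω hω (s * z) * Coset21.CharTwoKill.chi ω hω (t * z'))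
      = ∑ t, (∑ s, fcoef hω (fun x => fcoef hω (H x) t) s * Coset21.CharTwoKill.chi ω hω (s * z))
          * Coset21.CharTwoKill.chi ω hω (t * z') := by
        rw [sum_comm]
        refine sum_congr rfl fun t _ => ?_
        rw [sum_mul]
        refine sum_congr rfl fun s _ => ?_
        rw [fcoef₂, mul_assoc]
    _ = ∑ t, fcoef hω (H z) t * Coset21.CharTwoKill.chi ω hω (t * z') := by
        refine sum_congr rfl fun t _ => ?_
        rw [fourier_inv hp5 hω]
    _ = H z z' := fourier_inv hp5 hω (H z) z'

/-- a non-constant `H : 𝔽_p² → K` has a nonzero Fourier coefficient at a nonzero frequency pair -/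
theorem exists_fcoef₂_ne_zero (hp5 : 5 ≤ p) {ω : K} (hω : IsPrimitiveRoot ω p) (H : ZMod p → ZMod p → K)
    {x y x' y' : ZMod p} (h : H x y ≠ H x' y') : ∃ s t, ¬ (s = 0 ∧ t = 0) ∧ fcoef₂ hω H s t ≠ 0 := by
  classical
  by_contra hc
  have h' : ∀ s t, ¬ (s = 0 ∧ t = 0) → fcoef₂ hω H s t = 0 := fun s t hst =>
    Classical.byContradiction fun hne => hc ⟨s, t, hst, hne⟩
  have hconst : ∀ z z', H z z' = fcoef₂ hω H 0 0 := by
    intro z z'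
    rw [← fourier_inv₂ hp5 hω H z z', sum_eq_single (0 : ZMod p)]
    · rw [sum_eq_single (0 : ZMod p)]
      · simp only [zero_mul, AddChar.map_zero_eq_one, mul_one]
      · intro t _ ht
        rw [h' 0 t (fun hh => ht hh.2), zero_mul]
      · intro h0
        exact absurd (mem_univ _) h0
    · intro s _ hs
      refine sum_eq_zero fun t _ => ?_
      rw [h' s t (fun hh => hs hh.1), zero_mul]
    · intro h0
      exact absurd (mem_univ _) h0
  exact h (by rw [hconst x y, hconst x' y'])

/-- TWO-LABEL pattern of a row family against ALL column pairs: `[H_i(⟨(1,a_i), w¹⟩, ⟨(1,a_i), w²⟩)]_{i, (w¹,w²)}` -/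
def famPat₂ {r : ℕ} {ι : Type*} (a : ι → Fin r → ZMod p) (H : ι → ZMod p → ZMod p → K) :
    Matrix ι ((Fin (r + 1) → ZMod p) × (Fin (r + 1) → ZMod p)) K :=
  Matrix.of fun i w => H i (lineRep p r (a i) ⬝ᵥ w.1) (lineRep p r (a i) ⬝ᵥ w.2)

/-- two-label line-block matrix `M₂[i,(u¹,u²)] = Σ_{(s,t) : s•(1,a_i) = u¹, t•(1,a_i) = u²} Ĥ_i(s,t)` -/
noncomputable def famMat₂ {ω : K} (hω : IsPrimitiveRoot ω p) {r : ℕ} {ι : Type*} (a : ι → Fin r → ZMod p)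
    (H : ι → ZMod p → ZMod p → K) : Matrix ι ((Fin (r + 1) → ZMod p) × (Fin (r + 1) → ZMod p)) K :=
  Matrix.of fun i u => ∑ s : ZMod p, ∑ t : ZMod p,
    if s • lineRep p r (a i) = u.1 ∧ t • lineRep p r (a i) = u.2 then fcoef₂ hω (H i) s t else 0

/-- the character matrix of `𝔽_p^r × 𝔽_p^r`: the Kronecker square `F ⊗ F`, `(F ⊗ F)[(u¹,u²),(w¹,w²)] = ψ(⟨u¹,w¹⟩) ψ(⟨u²,w²⟩)` -/
noncomputable def charMat₂ {ω : K} (hω : IsPrimitiveRoot ω p) (r : ℕ) :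
    Matrix ((Fin r → ZMod p) × (Fin r → ZMod p)) ((Fin r → ZMod p) × (Fin r → ZMod p)) K :=
  charMat hω r ⊗ₖ charMat hω r

/-- `F ⊗ F` is invertible -/
theorem isUnit_charMat₂_det (hp5 : 5 ≤ p) {ω : K} (hω : IsPrimitiveRoot ω p) (r : ℕ) : IsUnit (charMat₂ hω r).det := by
  classical
  rw [charMat₂, Matrix.det_kronecker]
  exact ((isUnit_charMat_det hp5 hω r).pow _).mul ((isUnit_charMat_det hp5 hω r).pow _)

/-- `P₂ = M₂ · (F ⊗ F)` (two-variable Fourier inversion row by row) -/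
theorem famMat₂_mul_charMat₂ (hp5 : 5 ≤ p) {ω : K} (hω : IsPrimitiveRoot ω p) {r : ℕ} {ι : Type*}
    (a : ι → Fin r → ZMod p) (H : ι → ZMod p → ZMod p → K) :
    famMat₂ hω a H * charMat₂ hω (r + 1) = famPat₂ a H := by
  classical
  ext i w
  rw [Matrix.mul_apply, famPat₂, Matrix.of_apply]
  have h1 : ∀ u, famMat₂ hω a H i u * charMat₂ hω (r + 1) u w
      = ∑ s, ∑ t, if s • lineRep p r (a i) = u.1 ∧ t • lineRep p r (a i) = u.2 then
          fcoef₂ hω (H i) s t * (Coset21.CharTwoKill.chi ω hω (u.1 ⬝ᵥ w.1) * Coset21.CharTwoKill.chi ω hω (u.2 ⬝ᵥ w.2))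
        else 0 := by
    intro u
    rw [famMat₂, Matrix.of_apply, charMat₂, Matrix.kroneckerMap_apply, charMat, Matrix.of_apply, Matrix.of_apply, sum_mul]
    refine sum_congr rfl fun s _ => ?_
    rw [sum_mul]
    refine sum_congr rfl fun t _ => ?_
    split_ifs
    · rfl
    · rw [zero_mul]
  simp_rw [h1]
  rw [sum_comm]
  have h2 : ∀ s : ZMod p, ∑ u : (Fin (r + 1) → ZMod p) × (Fin (r + 1) → ZMod p), ∑ t : ZMod p,
      (if s • lineRep p r (a i) = u.1 ∧ t • lineRep p r (a i) = u.2 then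
          fcoef₂ hω (H i) s t * (Coset21.CharTwoKill.chi ω hω (u.1 ⬝ᵥ w.1) * Coset21.CharTwoKill.chi ω hω (u.2 ⬝ᵥ w.2))
        else 0)
      = ∑ t : ZMod p, fcoef₂ hω (H i) s t * (Coset21.CharTwoKill.chi ω hω (s * (lineRep p r (a i) ⬝ᵥ w.1))
          * Coset21.CharTwoKill.chi ω hω (t * (lineRep p r (a i) ⬝ᵥ w.2))) := by
    intro s
    rw [sum_comm]
    refine sum_congr rfl fun t _ => ?_
    rw [Fintype.sum_eq_single (s • lineRep p r (a i), t • lineRep p r (a i))]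
    · simp [smul_dotProduct]
    · intro u hu
      rw [if_neg]
      rintro ⟨hu1, hu2⟩
      exact hu (Prod.ext hu1.symm hu2.symm)
  simp_rw [h2]
  exact fourier_inv₂ hp5 hω (H i) (lineRep p r (a i) ⬝ᵥ w.1) (lineRep p r (a i) ⬝ᵥ w.2)

omit [CharP K 2] in
/-- rows `i`, columns `(s(i)•(1,a_i), t(i)•(1,a_i))` with one frequency PAIR `≠ (0,0)` per row: the two-label line-block matrix is DIAGONAL —
the frequency pairs of two distinct affine points `(1,a_i)`, `(1,a_{i'})` meet only at `(0,0)` -/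
theorem famMat₂_submatrix {ω : K} (hω : IsPrimitiveRoot ω p) {r : ℕ} {ι : Type*} [DecidableEq ι] (a : ι → Fin r → ZMod p)
    (ha : Function.Injective a) (H : ι → ZMod p → ZMod p → K) (s t : ι → ZMod p) (hst : ∀ i, ¬ (s i = 0 ∧ t i = 0)) :
    (famMat₂ hω a H).submatrix (fun i => i) (fun i => (s i • lineRep p r (a i), t i • lineRep p r (a i)))
      = Matrix.diagonal fun i => fcoef₂ hω (H i) (s i) (t i) := by
  classical
  have hfst : ∀ i i' (s' s₀ : ZMod p), s' • lineRep p r (a i) = s₀ • lineRep p r (a i') → s' = s₀ := by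
    intro i i' s' s₀ h
    have := congrFun h 0
    simpa [lineRep] using this
  have hline : ∀ i i' (s₀ : ZMod p), s₀ ≠ 0 → s₀ • lineRep p r (a i) = s₀ • lineRep p r (a i') → i = i' := by
    intro i i' s₀ hs₀ h
    have hinj : lineRep p r (a i) = lineRep p r (a i') := smul_right_injective _ hs₀ h
    apply ha
    funext j
    have := congrFun hinj j.succ
    simpa [lineRep] using this
  ext i i'
  rw [Matrix.submatrix_apply, famMat₂, Matrix.of_apply, Matrix.diagonal_apply]
  by_cases h : i = i'
  · subst h
    rw [if_pos rfl, Fintype.sum_eq_single (s i)]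
    · rw [Fintype.sum_eq_single (t i)]
      · simp
      · intro t' ht'
        rw [if_neg]
        rintro ⟨-, h2⟩
        exact ht' (hfst i i t' (t i) h2)
    · intro s' hs'
      refine sum_eq_zero fun t' _ => ?_
      rw [if_neg]
      rintro ⟨h1, -⟩
      exact hs' (hfst i i s' (s i) h1)
  · rw [if_neg h]
    refine sum_eq_zero fun s' _ => sum_eq_zero fun t' _ => ?_
    rw [if_neg]
    rintro ⟨h1, h2⟩
    have e1 : s' = s i' := hfst i i' s' (s i') h1
    have e2 : t' = t i' := hfst i i' t' (t i') h2
    rw [e1] at h1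
    rw [e2] at h2
    by_cases hs0 : s i' = 0
    · exact h (hline i i' (t i') (fun ht0 => hst i' ⟨hs0, ht0⟩) h2)
    · exact h (hline i i' (s i') hs0 h1)

/-- **LEMMA N5 (NODE-g28 §5e): TWO-LABEL ONE-SIDED SATURATION.**  Rows: any injective family of affine points `(1,a_i)`, `a : ι → 𝔽_p^r`
injective, with row-dependent NON-CONSTANT two-label tables `H_i : 𝔽_p² → K`; columns: ALL pairs `(w¹,w²) ∈ 𝔽_p^{r+1} × 𝔽_p^{r+1}`.  Then
`[H_i(⟨(1,a_i), w¹⟩, ⟨(1,a_i), w²⟩)]_{i,(w¹,w²)}` has rank `≥ |ι|` over every characteristic-two `K ∋ μ_p`. -/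
theorem rank_famPat₂_ge (hp5 : 5 ≤ p) {ω : K} (hω : IsPrimitiveRoot ω p) {r : ℕ} {ι : Type*} [Fintype ι]
    (a : ι → Fin r → ZMod p) (ha : Function.Injective a) (H : ι → ZMod p → ZMod p → K)
    (hH : ∀ i, ∃ x y x' y', H i x y ≠ H i x' y') : Fintype.card ι ≤ (famPat₂ a H).rank := by
  classical
  have hch : ∀ i, ∃ s₀ t₀ : ZMod p, ¬ (s₀ = 0 ∧ t₀ = 0) ∧ fcoef₂ hω (H i) s₀ t₀ ≠ 0 := fun i => by
    obtain ⟨x, y, x', y', hne⟩ := hH i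
    exact exists_fcoef₂_ne_zero hp5 hω _ hne
  choose s t hst hsc using hch
  rw [← famMat₂_mul_charMat₂ hp5 hω a H,
    Matrix.rank_mul_eq_left_of_isUnit_det _ _ (isUnit_charMat₂_det hp5 hω (r + 1))]
  refine le_trans ?_ (Matrix.rank_submatrix_le (famMat₂ hω a H) (fun i => i)
    (fun i => (s i • lineRep p r (a i), t i • lineRep p r (a i))))
  rw [famMat₂_submatrix hω a ha H s t hst]
  have hu : IsUnit (Matrix.diagonal fun i => fcoef₂ hω (H i) (s i) (t i)) := by
    rw [Matrix.isUnit_iff_isUnit_det, Matrix.det_diagonal]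
    exact isUnit_iff_ne_zero.mpr (prod_ne_zero_iff.mpr fun i _ => hsc i)
  rw [Matrix.rank_of_isUnit _ hu]

/-- the same through a product of affine reparametrisations `w¹ ↦ N₁w¹ + w₁`, `w² ↦ N₂w² + w₂` of the two column labels
(`N₁ * N₁' = 1`, `N₂ * N₂' = 1`) -/
theorem rank_famPat₂_flat_ge (hp5 : 5 ≤ p) {ω : K} (hω : IsPrimitiveRoot ω p) {r : ℕ} {ι : Type*} [Fintype ι]
    (a : ι → Fin r → ZMod p) (ha : Function.Injective a) (H : ι → ZMod p → ZMod p → K)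
    (hH : ∀ i, ∃ x y x' y', H i x y ≠ H i x' y') (w₁ w₂ : Fin (r + 1) → ZMod p)
    (N₁ N₁' N₂ N₂' : Matrix (Fin (r + 1)) (Fin (r + 1)) (ZMod p)) (hN₁ : N₁ * N₁' = 1) (hN₂ : N₂ * N₂' = 1) :
    Fintype.card ι ≤ (Matrix.of fun i (w : (Fin (r + 1) → ZMod p) × (Fin (r + 1) → ZMod p)) =>
      H i (lineRep p r (a i) ⬝ᵥ (N₁.mulVec w.1 + w₁)) (lineRep p r (a i) ⬝ᵥ (N₂.mulVec w.2 + w₂))).rank := by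
  classical
  have hsub : (Matrix.of fun i (w : (Fin (r + 1) → ZMod p) × (Fin (r + 1) → ZMod p)) =>
      H i (lineRep p r (a i) ⬝ᵥ (N₁.mulVec w.1 + w₁)) (lineRep p r (a i) ⬝ᵥ (N₂.mulVec w.2 + w₂))).submatrix
      (fun i => i) (fun w => (N₁'.mulVec (w.1 - w₁), N₂'.mulVec (w.2 - w₂)))
      = famPat₂ a H := by
    ext i w
    rw [Matrix.submatrix_apply, Matrix.of_apply, famPat₂, Matrix.of_apply, Matrix.mulVec_mulVec, Matrix.mulVec_mulVec, hN₁, hN₂,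
      Matrix.one_mulVec, Matrix.one_mulVec, sub_add_cancel, sub_add_cancel]
  have h1 := rank_famPat₂_ge hp5 hω a ha H hH
  rw [← hsub] at h1
  exact h1.trans (Matrix.rank_submatrix_le _ _ _)

variable {n : ℕ}

/-- **THE TWO-LABEL RECTANGLE KILL ((P3)₂ of NODE-g28 §5e).**  Registers `k`-form except `g₀`; rows ANY family `X i`, columns `Y w` indexed by
ALL PAIRS `w = (w¹,w²) ∈ 𝔽_p^{r+1} × 𝔽_p^{r+1}` (a column family whose two labelled cross-statistics are JOINTLY saturated), disjoint supports,
`g₀` live on the rectangle and firing there as `G_i(⟨(1,a_i), N₁w¹ + w₁⟩, ⟨(1,a_i), N₂w² + w₂⟩)` for an injective `a : ι → 𝔽_p^r` and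
ROW-DEPENDENT non-constant two-label tables `G_i : 𝔽_p² → Bool`; `|ι| > (n+1)·2p^k + 1` forces a losing input (tree `loss_of_rectRank` +
`rank_famPat₂_flat_ge` over `𝔽₂(μ_{3p})`).  After the merge law (part G) the two END registers of `TwoQuadNoPerfectOdd` form one such `g₀`. -/
theorem loss_of_twoLabelRectangle (hp5 : 5 ≤ p) {k r : ℕ} {ι : Type*} [Fintype ι] (c : ℕ)
    (y : Fin (n + 1) → (Fin n → Bool) → Bool) (g₀ : Fin (n + 1))
    (lam : Fin (n + 1) → Fin k → Fin n → ZMod p) (F : Fin (n + 1) → (Fin k → ZMod p) → Bool)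
    (hF : ∀ g, g ≠ g₀ → ∀ u, y g u = F g (fun j => ∑ i, if u i = true then lam g j i else 0))
    (X : ι → Fin n → Bool) (Y : (Fin (r + 1) → ZMod p) × (Fin (r + 1) → ZMod p) → Fin n → Bool)
    (hd : ∀ i w l, ¬ (X i l = true ∧ Y w l = true))
    (G : ι → ZMod p → ZMod p → Bool) (hG : ∀ i, ∃ b₁ b₂ b₁' b₂', G i b₁ b₂ ≠ G i b₁' b₂')
    (a : ι → Fin r → ZMod p) (ha : Function.Injective a) (w₁ w₂ : Fin (r + 1) → ZMod p)
    (N₁ N₁' N₂ N₂' : Matrix (Fin (r + 1)) (Fin (r + 1)) (ZMod p)) (hN₁ : N₁ * N₁' = 1) (hN₂ : N₂ * N₂' = 1)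
    (hpat : ∀ i w, y g₀ (bor (X i) (Y w))
      = G i (lineRep p r (a i) ⬝ᵥ (N₁.mulVec w.1 + w₁)) (lineRep p r (a i) ⬝ᵥ (N₂.mulVec w.2 + w₂)))
    (hlive : ∀ i w, liveCut c (bor (X i) (Y w)) g₀ = true)
    (ht : (n + 1) * (p ^ k * 2) + 1 < Fintype.card ι) :
    ∃ u, ringWinU c y u = false := by
  classical
  obtain ⟨hK, ω, -, hω, -⟩ := Coset21.exists_charTwo_roots p hp5
  haveI := hK
  refine loss_of_rectRank hp5 c y g₀ lam F hF X Y hd (lt_of_lt_of_le ht ?_)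
  have hrect : rect (Kp p) (fun u => y g₀ u && liveCut c u g₀) X Y
      = Matrix.of fun i (w : (Fin (r + 1) → ZMod p) × (Fin (r + 1) → ZMod p)) =>
          (fun i z z' => if G i z z' = true then (1 : Kp p) else 0) i
            (lineRep p r (a i) ⬝ᵥ (N₁.mulVec w.1 + w₁)) (lineRep p r (a i) ⬝ᵥ (N₂.mulVec w.2 + w₂)) := by
    ext i w
    rw [rect, Matrix.of_apply, Matrix.of_apply]
    simp only [hpat i w, hlive i w, Bool.and_true]
  rw [hrect]
  refine rank_famPat₂_flat_ge hp5 hω a ha (fun i z z' => if G i z z' = true then (1 : Kp p) else 0) ?_ w₁ w₂ N₁ N₁' N₂ N₂' hN₁ hN₂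
  intro i
  obtain ⟨b₁, b₂, b₁', b₂', hb⟩ := hG i
  refine ⟨b₁, b₂, b₁', b₂', ?_⟩
  intro h
  apply hb
  cases h1 : G i b₁ b₂ <;> cases h2 : G i b₁' b₂' <;> simp_all

end TwoLabel

end Summit.QuantumAdvantage.QuantumAdvantage.Theorems.LivenessSeparation
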